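import Summits.QuantumFields.BalabanUV.T4Continuum.Support.NE7PinnedLandauRepB8
import Summits.QuantumFields.BalabanUV.T4Continuum.Support.NE7ApeCurvedRepSameTopCritical
import Summits.QuantumFields.BalabanUV.T4Continuum.Support.NE7TopMismatchLetters
import HarnessLib

/-!
# NE7ApeCurvedRepPinnedB8 — (APE) WITH A DATUM AT A TANGENT-CRITICAL BACKGROUND, THE REPRESENTATIVE PRODUCED (PINNED, (1.38)-LANDAU) MODULO THE LHCI: F78 ∘ F91 —
# (APE) with a datum ⇐ LHCI_{B8}(W) + (L1)′ + α₁ + (L2), where (L1)′ and the gradient member are now quantified over PINNED-TOP Landau representatives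
# (`cavgIter (We^{Z}) = cavgIter W`, so the datum to be lifted is `D_W Z = O(α₀²)`); file 26

Cell `pub-balaban`, rung (B)+1 sub-cell t4, lineage `b2b-balaban-t4-ne7-p1` (CRUX PROVER NE7 #1 = OWNER of row NE7), generation 77; memo
`t4/b2b-balaban-t4-ne7-p1-g77/GAUGED-TOP-TT.md` §3∕§5∕§8.  File F92 (over F78 `NE7ApeCurvedRepSameTopCritical.smallField_of_tanCritical_repSameTop_critBackground` (the
fibre-preserving representative as hypotheses; hTT by F75, (L3) discharged), F91 `NE7PinnedLandauRepB8.exists_pinnedLandauRepB8_of_lhci` (the pinned representative modulo the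
LHCI), F74 `NE7TopMismatchLetters.cavgIter_gaugeAct_eq_of_pinned` (a pinned gauge keeps the top)).
WHY (memo §3).  F86 docked E′'s UNPINNED representative with the conjugated transport; its (L1) letter is not dischargeable (the finite coarse gauge transform of the top
leaves an `O(θ_u²)` non-gauge datum).  With the PINNED representative of F91 the top of `We^{Z}` IS the top of `W`, so the (L1) provider sees a datum `D_W Z = O(α₀²)`; THIS FILE
is the corresponding (APE) docking — F78 with the representative PRODUCED — and it passes the top information into the (L1)∕gradient quantifiers (`hNlift`, `hGrad` take
`cavgIter (vary W Z 1) = cavgIter W` as a premise), repairing the ∀-form defect noted in memo §3 (a).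
WHAT ([folklore]; 0 def, 0 sorry).  **`smallField_of_tanCritical_pinnedRepB8_of_lhci`** — F78's conclusion (radius with `τ` of F75, `κ = 0`) from: the background∕field
hypotheses of F78, `cavgIter U = cavgIter W`, the initial gauge `r₀`, `b₀`, row NE3's class data of `W`, the LHCI of `W` by shape, E′'s regime at the PG constants,
`2r̄ ≤ α₀`, and the letters (L1)′, `α₁`, (L2) on `S`.
HONEST FRAMING (page 1): composition; the LHCI, (L1)′, `α₁`, (L2) are HYPOTHESES; whether the displayed radius is `< δ∕M²` is decided only when they are supplied; nothing of
Bałaban's asserted; (APE) on curved data NOT proved; NOT ONE-STEP, NOT NE7; spine 0∕9; finite T⁴ rung (B)+1 — NOT infinite volume, NOT mass gap, NOT `BetaPertH`, NOT Clay.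
Continuum YM on T⁴ ⇐ BetaPertH ∧ nine spine estimates (0/9 proved); BetaPertH ⇐ (D1) ∧ (D4) ∧ CAP+tail; G-an2-4 gates asym, D1 and NE2/3/4.
-/

set_option autoImplicit false

open scoped BigOperators Matrix Matrix.Norms.L2Operator
open NormedSpace Finset Set

namespace Summit.QuantumFields.BalabanUV.T4Continuum.NE7ApeCurvedRepPinnedB8

open Literature.MathematicalPhysics.QuantumFieldTheory.Balaban1983to89
open B7Prop1Explicit B7Prop2Explicit MatrixLog UnitaryModel
open T4AveragingDeficitWall (Ad IsUnitaryCfg IsSkewDir SmallField vary curlAt dirL1)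
open T4AveragingDeficitWallBoundary (IsPeriodicCfg periodBox)
open AveragingDeficitPeriodicCounting (IsPeriodicDir)
open AveragingDeficitTwoLevelPrep (twoLevelSmall)
open AveragingDeficitMultiLevelPrep (cavgIter LevelSmall)
open MinimalActionLevels (perWin)
open BlockAverageVaryHolo (nbRad)
open BlockAveragePushDirGauge (gaugeDir)
open NE3HessForm (hess dAction)
open NE3TangentCovariantTower (dirIter)
open NE3EnergyShapes (IsUnitarySite IsPeriodicSite)
open NE3CovariantWeitzenbock (covDiv)
open NE3CovariantCalculus (hsR)
open NE3RightInverseSupLetters (frameC)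
open NE3QbarIterCovLiftPrep (cruxC)
open NE3RightInverseSolveLetters (thetaLoc)
open NE3HatInvCurlLetters (curl1C)
open NE3.PairLandauB8 (covLapSite avgKernelGauges IsLandauB8)
open NE7ApeCurvedRepSameTopCritical (smallField_of_tanCritical_repSameTop_critBackground)
open NE7PinnedLandauRepB8 (exists_pinnedLandauRepB8_of_lhci)
open NE7TopMismatchLetters (cavgIter_gaugeAct_eq_of_pinned)

noncomputable section

variable {d : ℕ} {n : Type*} [Fintype n] [DecidableEq n]

/-- **(APE) WITH A DATUM AT A TANGENT-CRITICAL BACKGROUND, PINNED (1.38)-LANDAU REPRESENTATIVE PRODUCED MODULO THE LHCI** (statement in the module docstring). [folklore] -/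
theorem smallField_of_tanCritical_pinnedRepB8_of_lhci [Nonempty n] (hd : 2 ≤ d) {L N : ℕ} [NeZero N] (hL : 2 ≤ L) (j : ℕ)
    -- the background
    {W : Site d → Fin d → (Matrix n n ℂ)ˣ} {x : ℝ} (hWu : IsUnitaryCfg W) (hWP : IsPeriodicCfg W ((N * L ^ (j + 1) : ℕ) : ℤ))
    (hx : 0 ≤ x) (hs : LevelSmall d L j x) (hWx : SmallField W x)
    -- the sup radius of the representative and the regime at `x′ = x + 4(e^{α₀} − 1)`
    {α₀ : ℝ} (hα0 : 0 ≤ α₀) (hs' : LevelSmall d L j (x + 4 * (Real.exp α₀ - 1)))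
    (hθ : cruxC d L * (((L : ℝ) ^ (j + 1)) ^ 2 * (x + 4 * (Real.exp α₀ - 1))) < 1)
    (hθl : thetaLoc d L * (((L : ℝ) ^ (j + 1)) ^ 2 * (x + 4 * (Real.exp α₀ - 1))) < 1)
    (hε : ((L : ℝ) ^ (j + 1)) ^ 2 * (x + 4 * (Real.exp α₀ - 1)) ≤ 1)
    -- the field: of the class, tangent-critical
    {U : Site d → Fin d → (Matrix n n ℂ)ˣ} (hUu : IsUnitaryCfg U) (hUP : IsPeriodicCfg U ((N * L ^ (j + 1) : ℕ) : ℤ))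
    {xU : ℝ} (hxU : 0 ≤ xU) (hsU : LevelSmall d L j xU) (hUxU : SmallField U xU)
    (hcritU : ∀ Y : Site d → Fin d → Matrix n n ℂ, IsSkewDir Y → IsPeriodicDir Y ((N * L ^ (j + 1) : ℕ) : ℤ) →
      dirIter L (j + 1) U Y = 0 → dAction U Y (perWin d (N * L ^ (j + 1))) = 0)
    -- NEW: the field lies over `W`'s datum; its initial (−1)∕(−2) gauge relative to `W`
    (hTopUW : cavgIter L (j + 1) U = cavgIter L (j + 1) W)
    {r₀ b₀ : ℝ} (hr₀ : ∀ (y : Site d) (μ : Fin d), ‖(((W y μ)⁻¹ * U y μ : (Matrix n n ℂ)ˣ) : (Matrix n n ℂ)) - 1‖ ≤ r₀)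
    (hb₀ : ∀ x : Site d, ‖covDiv W (fun y μ => mlog (((W y μ)⁻¹ * U y μ : (Matrix n n ℂ)ˣ) : (Matrix n n ℂ))) x‖ ≤ b₀)
    -- row NE3's class data of `W` (plaquette-gradient radius, E′'s radius lines)
    {x₁ : ℝ} (hx10 : 0 ≤ x₁)
    (hgrad : ∀ (p : Site d) (μ κ : Fin d), κ ≠ μ →
      ‖Ad (W p μ) ((hol W (p + e μ) (plaqWord κ μ) : (Matrix n n ℂ)ˣ) : Matrix n n ℂ) - ((hol W p (plaqWord κ μ) : (Matrix n n ℂ)ˣ) : Matrix n n ℂ)‖ ≤ x₁)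
    (hbx : 23040 * (d : ℝ) ^ 4 * (frameC d L + d) ^ 2 * ((L : ℝ) ^ (j + 1)) ^ 2 * x ≤ 1)
    (hcx : 11520 * (d : ℝ) ^ 4 * (frameC d L + d) ^ 3 * ((L : ℝ) ^ (j + 1)) ^ 3 * x₁ ≤ 1)
    -- the LHCI of `W` by shape (memo §5∕§8): existence with the Laplacian bound, uniqueness
    {CI : ℝ} (hCI : 0 ≤ CI)
    (hI : ∀ a : Site d → Matrix n n ℂ, (∀ w, a w ∈ skewAdjoint (Matrix n n ℂ)) → (∀ (w : Site d) (i : Fin d), a (w + (N : ℤ) • e i) = a w) →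
      ∃ eta : Site d → Matrix n n ℂ,
        (∀ y, eta y ∈ skewAdjoint (Matrix n n ℂ)) ∧ (∀ (y : Site d) (i : Fin d), eta (y + ((N * L ^ (j + 1) : ℕ) : ℤ) • e i) = eta y) ∧
        (∀ w : Site d, eta ((((L ^ (j + 1) : ℕ) : ℤ)) • w) = a w) ∧
        IsLandauB8 (d := d) L N (j + 1) W (gaugeDir W eta) ∧
        ∀ A : ℝ, (∀ w, ‖a w‖ ≤ A) → ∀ y, ‖covLapSite W eta y‖ ≤ CI / ((L : ℝ) ^ (j + 1)) ^ 2 * A)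
    (hIu : ∀ mu : Site d → Matrix n n ℂ, (∀ y, mu y ∈ skewAdjoint (Matrix n n ℂ)) →
      (∀ (y : Site d) (i : Fin d), mu (y + ((N * L ^ (j + 1) : ℕ) : ℤ) • e i) = mu y) → (∀ w : Site d, mu ((((L ^ (j + 1) : ℕ) : ℤ)) • w) = 0) →
      (∀ nu ∈ avgKernelGauges (d := d) (n := n) L N (j + 1) W,
        ∑ y ∈ periodBox (d := d) (N * L ^ (j + 1)), hsR (covLapSite W mu y) (covLapSite W nu y) = 0) →
      ∀ y, covLapSite W mu y = 0)
    -- the constants (F83's `c₀`, `c₁`; E′'s `c_R`; the PG `c_R`), named; E′'s regime at these constants; the sup radius `α₀ ≥ 2r̄`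
    {c₀ c₁ cR cRE : ℝ} (hc₁ : c₁ = 36 * d * (d : ℝ)) (hc₀ : c₀ = 36 * d * (d : ℝ) ^ 2)
    (hcRE : cRE = 1 + 2 * (Fintype.card n : ℝ) * (64 * (d : ℝ) ^ 2 * N) ^ d + 27 * (Fintype.card n : ℝ) ^ 3 * (512 : ℝ) ^ d * (N : ℝ) ^ d)
    (hcR : cR = cRE * (1 + CI * (36 * d * (frameC d L + d) ^ 2)))
    (hreg₁ : c₀ * ((L : ℝ) ^ (j + 1)) ^ 2 * (cR * b₀) ≤ 1 / 10) (hreg₂ : c₁ * (L : ℝ) ^ (j + 1) * (cR * b₀) ≤ 1 / 25)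
    (hreg₃ : r₀ + 5 / 2 * (c₁ * (L : ℝ) ^ (j + 1) * (cR * b₀)) ≤ 1 / 20)
    (hline : cR * (4 * (c₀ * ((L : ℝ) ^ (j + 1)) ^ 2) * (b₀ + 4 * (cR * b₀))
        + 25 * d * (r₀ + 5 / 2 * (c₁ * (L : ℝ) ^ (j + 1) * (cR * b₀))) * (c₁ * (L : ℝ) ^ (j + 1))
        + 14 * d * (c₁ * (L : ℝ) ^ (j + 1)) ^ 2 * (cR * b₀)) ≤ 1 / 2)
    (hα₀ : 2 * (r₀ + 5 / 2 * (c₁ * (L : ℝ) ^ (j + 1) * (cR * b₀))) ≤ α₀)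
    -- the remaining analytic letters at `W`: (L1) normal lift of `Z`, the gradient member, (L2) slice solver, (L3) tension
    (S : Set (Site d → Fin d → Matrix n n ℂ)) {cN KG ν : ℝ} (hν : 0 ≤ ν)
    -- (L1) the normal lift and the gradient member, for every PINNED-TOP (1.38)-Landau `Z` of sup radius `α₀`
    (hNlift : ∀ Z : Site d → Fin d → Matrix n n ℂ, IsSkewDir Z → IsPeriodicDir Z ((N * L ^ (j + 1) : ℕ) : ℤ) →
      IsLandauB8 (d := d) L N (j + 1) W Z → (∀ y μ, ‖Z y μ‖ ≤ α₀) → cavgIter L (j + 1) (vary W Z 1) = cavgIter L (j + 1) W →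
      ∃ AN : Site d → Fin d → Matrix n n ℂ, IsPeriodicDir AN ((N * L ^ (j + 1) : ℕ) : ℤ) ∧
        dirIter L (j + 1) W AN = dirIter L (j + 1) W Z ∧
        (∀ z μ' ν', μ' ≠ ν' → ‖curlAt W AN z μ' ν'‖ ≤ cN) ∧
        (∀ Y : Site d → Fin d → Matrix n n ℂ, IsSkewDir Y → IsPeriodicDir Y ((N * L ^ (j + 1) : ℕ) : ℤ) → dirIter L (j + 1) W Y = 0 →
          |hess W AN Y (perWin d (N * L ^ (j + 1)))| ≤ ν * dirL1 Y (periodBox (d := d) (N * L ^ (j + 1)))) ∧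
        (fun y μ => Z y μ - AN y μ) ∈ S)
    {α₁ : ℝ} (hα1 : 0 ≤ α₁)
    (hGrad : ∀ Z : Site d → Fin d → Matrix n n ℂ, IsSkewDir Z → IsPeriodicDir Z ((N * L ^ (j + 1) : ℕ) : ℤ) →
      IsLandauB8 (d := d) L N (j + 1) W Z → (∀ y μ, ‖Z y μ‖ ≤ α₀) → cavgIter L (j + 1) (vary W Z 1) = cavgIter L (j + 1) W →
      ∀ (y : Site d) (κ τ : Fin d), ‖Ad (W (y + e κ) τ) (Z (y + e τ) κ) - Z y κ‖ ≤ α₁)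
    (hG : ∀ X ∈ S, IsPeriodicDir X ((N * L ^ (j + 1) : ℕ) : ℤ) → dirIter L (j + 1) W X = 0 → ∀ g : ℝ, 0 ≤ g →
      (∀ Y : Site d → Fin d → Matrix n n ℂ, IsSkewDir Y → IsPeriodicDir Y ((N * L ^ (j + 1) : ℕ) : ℤ) → dirIter L (j + 1) W Y = 0 →
        |hess W X Y (perWin d (N * L ^ (j + 1)))| ≤ g * dirL1 Y (periodBox (d := d) (N * L ^ (j + 1)))) →
      ∀ z μ' ν', μ' ≠ ν' → ‖curlAt W X z μ' ν'‖ ≤ KG * g)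
    -- (L3) DISCHARGED: the background is tangent-critical
    (hcritW : ∀ Y : Site d → Fin d → Matrix n n ℂ, IsSkewDir Y → IsPeriodicDir Y ((N * L ^ (j + 1) : ℕ) : ℤ) → dirIter L (j + 1) W Y = 0 →
      dAction W Y (perWin d (N * L ^ (j + 1))) = 0) :
    SmallField U (x + (KG * (
        ((x + 4 * (Real.exp α₀ - 1))
            * ((curl1C d L / (1 - thetaLoc d L * (((L : ℝ) ^ (j + 1)) ^ 2 * (x + 4 * (Real.exp α₀ - 1)))))
                * (((L : ℝ) ^ (j + 1)) ^ d / ((L : ℝ) ^ (j + 1)) ^ 2))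
            * (Real.exp (((L : ℝ) ^ d / L) * ((d : ℝ) * (16 * ((d : ℝ) + 1) * ((d : ℝ) + 4) * (L : ℝ) ^ 2)
                  * (1250 * ((nbRad d L : ℝ) + L) + 8 * ((d : ℝ) * L) + 2 * L)) * (2 / twoLevelSmall d L))
                * ((L : ℝ) / (L : ℝ) ^ d) ^ j
                * (((d : ℝ) * (2 * nbRad d L + 1) ^ d) * ((2 * (d : ℝ) + 4) * (L : ℝ) ^ 2) * (2 * (L : ℝ) ^ j) * (Real.exp α₀ - 1)
                  + (17 / 8 * ((L : ℝ) ^ 2) ^ j * (x + 4 * (Real.exp α₀ - 1)))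
                    * (((d : ℝ) * (2 * nbRad d L + 1) ^ d) * ((2 * (d : ℝ) + 4)
                          * (2 * (2 * L * (nbRad d L : ℝ) + 128 * ((d : ℝ) + 1) * ((d : ℝ) + 4) * (L : ℝ) ^ 2)))
                      + ((d : ℝ) * (2 * nbRad d L + 1) ^ d) * ((2 * (d : ℝ) + 4) * (L : ℝ) ^ 2 * (2 * (nbRad d L : ℝ))
                          + 2 * (8 * (L : ℝ) + (1250 * ((nbRad d L : ℝ) + L) + 8 * (d * L) + 2 * L))
                              * (16 * ((d : ℝ) + 1) * ((d : ℝ) + 4) * (L : ℝ) ^ 2))))))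
        + (Fintype.card (T4AveragingDeficitWall.Plane d) : ℝ)
          * (2 * (240 * (Real.exp α₀ - 1) * α₀ * (2 * α₁ + 24 * α₀ * (Real.exp α₀ - 1) + x) + 8 * α₀ * (2 * α₁ + 24 * α₀ * (Real.exp α₀ - 1))
              + 6 * (Real.exp α₀ - 1) * (2 * α₁ + 24 * (Real.exp α₀ - 1) * α₀)
              + (2 * α₁ + 24 * (Real.exp α₀ - 1) * α₀) * (2 * α₁ + 24 * α₀ * (Real.exp α₀ - 1))
              + 960 * (Real.exp α₀ - 1) * α₀ ^ 2 + 32 * x * α₀ ^ 2)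
            + (64 * α₀ * α₁ + 1024 * x * α₀ ^ 2))
        + ν) + cN + 28 * α₀ ^ 2)) := by
  have hd1 : 1 ≤ d := by omega
  have hL1 : 1 ≤ L := by omega
  -- F91: the pinned (1.38)-Landau representative, modulo the LHCI
  obtain ⟨u, Z, huU, huP, hZs, hZP, hrep, hu0, hLan, -, hZsup, -, -⟩ :=
    exists_pinnedLandauRepB8_of_lhci hd1 hL j hWu hWP hx hs hWx hx10 hgrad hbx hcx hCI hI hIu hc₁ hc₀ hcRE hcR hUu hUP hr₀ hb₀ hreg₁ hreg₂ hreg₃ hline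
  have hZα : ∀ y μ, ‖Z y μ‖ ≤ α₀ := fun y μ => (hZsup y μ).trans hα₀
  -- the pinned gauge keeps the top: `cavgIter (We^{Z}) = cavgIter (U^u) = cavgIter U = cavgIter W`
  have hpin : ∀ z : Site d, u (((L : ℤ) ^ (j + 1)) • z) = 1 := fun z => by
    have h := hu0 z
    push_cast at h
    exact h
  have hTopZ : cavgIter L (j + 1) (vary W Z 1) = cavgIter L (j + 1) W := by
    rw [← hrep]
    exact cavgIter_gaugeAct_eq_of_pinned hL1 j hUu hxU hsU hUxU hTopUW huU hpin
  -- the (L1) letters at this representative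
  obtain ⟨AN, hNP, hNexact, hN7, hNorth, hTS⟩ := hNlift Z hZs hZP hLan hZα hTopZ
  have hZ1 := hGrad Z hZs hZP hLan hZα hTopZ
  exact smallField_of_tanCritical_repSameTop_critBackground hd hL j hWu hWP hx hs hWx hα0 hs' hθ hθl hε hUu hxU hsU hUxU hcritU huU huP hZs hZP hrep hZα hTopZ
    S hν hNP hNexact hN7 hNorth hTS hα1 hZ1 hG hcritW

end

end Summit.QuantumFields.BalabanUV.T4Continuum.NE7ApeCurvedRepPinnedB8
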